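import Literature.Algebra.Lie.IrreducibleSymplecticTransvectionDirection
import Literature.Algebra.Lie.SymplecticBireflectionGrading
import HarnessLib

/-!
# Lemma BL unconditionally: an irreducible `𝔤 ≤ 𝔰𝔭(M, ω)` normalised by an `(i, −i)`-bireflection IS `𝔰𝔭(M, ω)`
(no Katz Theorem 1.4 ∕ 1.5 ∕ Remark 1.4.1; `dim M ≥ 3` only; elementary)

The Hodge cell's lemma BL at the Lie level (crux K1Q; `Summits/HodgeConjecture/…/Q8BireflectionLieDensity.eq_skewAdjoint_of_bireflection`)
concludes `L = 𝔰𝔭(M, ω)` for an irreducible `L ≤ 𝔰𝔭(M, ω)` stable under `Ad γ`, `γ` an `(i, −i)`-bireflection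
(`γ v₊ = i v₊`, `γ v₋ = −i v₋`, `γ = 1` on `U = ⟨v₊, v₋⟩^⊥`, `ω(v₊, v₋) = 1`), GIVEN the four named facts
`Katz1990_thm14_gabber_of_ne`, `Katz1990_thm14_gabber_dim8`, `Katz1990_thm15_pseudoreflection`, `Katz1990_rmk141_nonsimple`
(Katz, *ESDE*, Ch. 1), for `6 ≤ dim M ≠ 7`.  THIS FILE proves the conclusion with NO named fact, for `dim M ≥ 3`, without the
isometry hypothesis on `γ`, over any algebraically closed field of characteristic `0` (and, with «trivial radical» as a
hypothesis, over any field of characteristic `0` containing `i`):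

* **`SymplecticBireflection.eq_skewAdjoint_of_isIrreducibleOn_of_conj_mem`** (trivial radical assumed; `i ∈ K`, `char K = 0`);
* **`SymplecticBireflection.eq_skewAdjoint_of_isIrreducibleOn_of_conj_mem'`** (`K` algebraically closed: no radical
  hypothesis) — the drop-in for `eq_skewAdjoint_of_bireflection` with `h14 h14' h15 h141`, `hγω`, `h6`, `h7` deleted.

## Proof (`s_{xy} = ω(·,x) y + ω(·,y) x`; the `Ad γ`-grading of the tree's `SymplecticBireflectionGrading`)

By (G2)–(G3) [tree], `L` contains a root `Y = s_{u₀ v₊}`, `u₀ ∈ U ∖ 0` (or the same for the datum `(v₋, −v₊, −i)`).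
CASE 1: `L` contains a transvection direction `s_{xx}`, `x ≠ 0` — then `L = 𝔰𝔭(M, ω)` by the seat's g57-#1
(`TransvectionDirection.eq_skewAdjoint_of_isIrreducibleOn_of_symSq_self_mem`).  CASE 2: it contains none — IMPOSSIBLE:
put `A₋ = {w ∈ U | s_{w v₋} ∈ L}` and `W = K v₊ ⊕ A₋`.  Every `X ∈ L` is `¼ (X₁ + X₋₁ + X_i + X₋ᵢ)` with `X_ρ ∈ L`,
`γ X_ρ = ρ X_ρ γ` (the order-4 projectors), and each `X_ρ` maps `W` into `W`:  `X_i = s_{u v₊}` (`u ∈ U`, (G3)) sends `v₊ ↦ 0`,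
`a ↦ ω(a,u) v₊`;  `X₋ᵢ = s_{w₁ v₋}` with `w₁ ∈ A₋` sends `v₊ ↦ w₁`, `a ↦ ω(a,w₁) v₋ = 0` because `[s_{a v₋}, s_{w₁ v₋}] =
ω(w₁,a) s_{v₋ v₋}` and `s_{v₋v₋} ∉ L`;  `X₁` commutes with `γ`, so `X₁ v₊ ∈ K v₊`, `X₁ v₋ ∈ K v₋`, `X₁ U ⊆ U` (G5) and
`s_{X₁ a, v₋} = [X₁, s_{a v₋}] − s_{a, X₁ v₋} ∈ L`, i.e. `X₁ A₋ ⊆ A₋`;  `X₋₁` kills `U` (G4) and `X₋₁ v₊ = β v₋` with `β = 0`,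
since `[X₋₁, s_{u₀ v₊}] = β s_{u₀ v₋}` and `[s_{u₀ v₊}, s_{u₀ v₋}] = −s_{u₀ u₀}` would put the transvection direction
`s_{u₀u₀}` in `L`.  So `W ∋ v₊` is `L`-stable, hence `W = M` by irreducibility — but `v₋ ∉ W` (`ω(v₋, v₊) = −1`).  ∎

THEOREMS ONLY (no definition, no instance, no notation, no named fact; no local instance attribute — `letI` inside the
statements; D-0026, net debt 0).  Lane `lit-hodgefound` (Track 2), prover seat `lit-hodgefound-p17`, generation 57, row g57-#2.
HONEST FRAME: Lie algebra only; K1Q ∕ HC are NOT proved here.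

## References

* [Katz1990ESDE] N. M. Katz, *Exponential Sums and Differential Equations*, Annals of Math. Studies 124 (1990), Ch. 1: the
  `Ad`-grading device of the proof of Thm. 1.0 (p. 9), and Thms. 1.4, 1.5, Rmk. 1.4.1 (pp. 10–11) which the conditional BL
  consumed — replaced here by the elementary argument above.
* [Deligne1980WeilII] P. Deligne, *La conjecture de Weil. II*, Publ. Math. IHÉS 52 (1980), Lemme 4.4.2ᵃ (p. 227) — the group
  form of CASE 1, for comparison.
* [FultonHarris1991] W. Fulton, J. Harris, *Representation Theory*, §16.1 (`Sym² V ≅ 𝔰𝔭(V)`).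
-/

namespace Literature.Algebra.Lie

namespace SymplecticBireflection

open Module KatzRecognition SymplecticSymmetricSquares TransvectionDirection
open LinearMap (BilinForm)

variable {K : Type*} [Field K] {V : Type*} [AddCommGroup V] [Module K V]

/-! ## §1 Two bracket computations in `Sym² ≅ 𝔰𝔭` -/

/-- `[s_{a v}, s_{w v}] = ω(w, a) s_{vv}` for `a, w` orthogonal to `v`. [cite: FultonHarris1991, §16.1] -/
theorem commutator_symSq_symSq_same_right {ω : BilinForm K V} (hω : ω.IsAlt) {a w v : V} (ha : ω a v = 0)
    (hw : ω w v = 0) :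
    symSq ω a v * symSq ω w v - symSq ω w v * symSq ω a v = ω w a • symSq ω v v := by
  have hva : ω v a = 0 := by rw [← LinearMap.IsAlt.neg hω a v, ha, neg_zero]
  rw [symSq_commutator hω, hva, hω v, hw, zero_smul, zero_smul, zero_smul, zero_add, zero_add, add_zero]

/-- `[s_{u v₊}, s_{u v₋}] = ω(v₋, v₊) s_{uu}` for `u` orthogonal to `v₊, v₋`. [cite: FultonHarris1991, §16.1] -/
theorem commutator_symSq_plus_symSq_minus {ω : BilinForm K V} (hω : ω.IsAlt) {u vp vm : V} (hup : ω u vp = 0)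
    (hum : ω u vm = 0) :
    symSq ω u vp * symSq ω u vm - symSq ω u vm * symSq ω u vp = ω vm vp • symSq ω u u := by
  have hmu : ω vm u = 0 := by rw [← LinearMap.IsAlt.neg hω u vm, hum, neg_zero]
  rw [symSq_commutator hω, hmu, hω u, hup, zero_smul, zero_smul, zero_smul, zero_add, add_zero, add_zero]

/-! ## §2 The `Ad γ`-projectors of a conjugation-stable subspace (order `4`) -/

section Projectors

variable {ω : BilinForm K V} (hω : ω.IsAlt) {i : K} (hi : i * i = -1) {vp vm : V} (hpm : ω vp vm = 1)
  {γ : V ≃ₗ[K] V} (hγp : γ vp = i • vp) (hγm : γ vm = (-i) • vm) (hγU : ∀ x, ω x vp = 0 → ω x vm = 0 → γ x = x)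

include hω hi hpm hγp hγm hγU in
/-- **The four `Ad γ`-components of a member of an `Ad γ`-stable subspace `L`** (`(Ad γ)⁴ = 1`, eigenvalues `1, −1, i, −i`):
`4 X = X₁ + X₋₁ + X_i + X₋ᵢ` with every `X_ρ ∈ L` and `γ X_ρ = ρ X_ρ γ` pointwise.
[cite: Katz1990ESDE, Ch. 1, proof of Thm. 1.0 (p. 9)] -/
theorem exists_components (L : Submodule K (Module.End K V)) (hL : ∀ X ∈ L, γ.conj X ∈ L) {X : Module.End K V}
    (hX : X ∈ L) :
    ∃ X₁ Xm Xi Xmi : Module.End K V, X₁ ∈ L ∧ Xm ∈ L ∧ Xi ∈ L ∧ Xmi ∈ L ∧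
      (4 : K) • X = X₁ + Xm + Xi + Xmi ∧ (∀ z, γ (X₁ z) = X₁ (γ z)) ∧ (∀ z, γ (Xm z) = -Xm (γ z)) ∧
      (∀ z, γ (Xi z) = i • Xi (γ z)) ∧ (∀ z, γ (Xmi z) = (-i) • Xmi (γ z)) := by
  set A := γ.conj with hAdef
  have hA4 : ∀ X, A (A (A (A X))) = X := conj_conj_conj_conj hω hi hpm hγp hγm hγU
  have hAX : A X ∈ L := hL X hX
  have hA2 : A (A X) ∈ L := hL _ hAX
  have hA3 : A (A (A X)) ∈ L := hL _ hA2
  refine ⟨X + A X + A (A X) + A (A (A X)), X - A X + A (A X) - A (A (A X)),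
    X - i • A X - A (A X) + i • A (A (A X)), X + i • A X - A (A X) - i • A (A (A X)),
    L.add_mem (L.add_mem (L.add_mem hX hAX) hA2) hA3, L.sub_mem (L.add_mem (L.sub_mem hX hAX) hA2) hA3,
    L.add_mem (L.sub_mem (L.sub_mem hX (L.smul_mem i hAX)) hA2) (L.smul_mem i hA3),
    L.sub_mem (L.sub_mem (L.add_mem hX (L.smul_mem i hAX)) hA2) (L.smul_mem i hA3), by module, ?_, ?_, ?_, ?_⟩
  · have heig : A (X + A X + A (A X) + A (A (A X))) = (1 : K) • (X + A X + A (A X) + A (A (A X))) := by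
      simp only [map_add, hA4, one_smul]; abel
    intro z; simpa only [one_smul] using apply_apply_eq_of_conj_eq_smul heig z
  · have heig : A (X - A X + A (A X) - A (A (A X))) = (-1 : K) • (X - A X + A (A X) - A (A (A X))) := by
      simp only [map_add, map_sub, hA4, neg_one_smul, neg_sub]; abel
    intro z; simpa only [neg_one_smul] using apply_apply_eq_of_conj_eq_smul heig z
  · have heig : A (X - i • A X - A (A X) + i • A (A (A X))) = i • (X - i • A X - A (A X) + i • A (A (A X))) := by
      simp only [map_add, map_sub, map_smul, hA4, smul_add, smul_sub, smul_smul, hi, neg_smul, one_smul]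
      abel
    exact apply_apply_eq_of_conj_eq_smul heig
  · have heig : A (X + i • A X - A (A X) - i • A (A (A X))) = (-i) • (X + i • A X - A (A X) - i • A (A (A X))) := by
      simp only [map_add, map_sub, map_smul, hA4, smul_add, smul_sub, smul_smul, hi, neg_smul, one_smul, neg_mul, neg_neg]
      abel
    exact apply_apply_eq_of_conj_eq_smul heig

end Projectors

/-! ## §3 BL, unconditionally -/

section Core

variable [CharZero K] [FiniteDimensional K V] {ω : BilinForm K V} (hωn : ω.Nondegenerate) (hω : ω.IsAlt) {i : K}
  (hi : i * i = -1) {vp vm : V} (hpm : ω vp vm = 1) {γ : V ≃ₗ[K] V} (hγp : γ vp = i • vp) (hγm : γ vm = (-i) • vm)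
  (hγU : ∀ x, ω x vp = 0 → ω x vm = 0 → γ x = x)

include hωn hω hi hpm hγp hγm hγU in
/-- **Core (`i`-case).** `L ≤ 𝔰𝔭(M, ω)` with trivial radical, `Ad γ`-stable, irreducible, containing a NON-ZERO `i`-eigen
operator `Y` (`γ Y = i Y γ`): then `L = 𝔰𝔭(M, ω)`.  Either `L` contains a transvection direction (g57-#1), or
`K v₊ ⊕ {w ∈ U | s_{w v₋} ∈ L}` is a proper non-zero `L`-stable subspace (module docstring) — impossible.
[cite: Katz1990ESDE, Ch. 1, proof of Thm. 1.0 (p. 9) and Thms. 1.4–1.5 (pp. 10–11, superseded here)] -/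
theorem eq_skewAdjoint_of_conj_mem_of_I_eigen :
    letI : LieRing (Module.End K V) := LieRing.ofAssociativeRing
    letI : LieAlgebra K (Module.End K V) := LieAlgebra.ofAssociativeAlgebra
    ∀ (L : LieSubalgebra K (Module.End K V)), LieAlgebra.HasTrivialRadical K L → L ≤ skewAdjointLieSubalgebra ω →
      (∀ X ∈ L, γ.conj X ∈ L) → IsIrreducibleOn L →
      ∀ {Y : Module.End K V}, Y ∈ L → Y ≠ 0 → (∀ z, γ (Y z) = i • Y (γ z)) → L = skewAdjointLieSubalgebra ω := by
  letI : LieRing (Module.End K V) := LieRing.ofAssociativeRing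
  letI : LieAlgebra K (Module.End K V) := LieAlgebra.ofAssociativeAlgebra
  intro L hrad hle hL hirr Y hYL hY0 hY
  have h2 : (2 : K) ≠ 0 := two_ne_zero
  have h4 : (4 : K) ≠ 0 := by norm_num
  have hmp : ω vm vp = -1 := apply_minus_plus hω hpm
  have hvp : vp ≠ 0 := by rintro rfl; rw [map_zero, LinearMap.zero_apply] at hpm; exact zero_ne_one hpm
  have hvm : vm ≠ 0 := by rintro rfl; rw [map_zero] at hpm; exact zero_ne_one hpm
  have hskew : ∀ X ∈ L, ∀ x y, ω (X x) y = -ω x (X y) := by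
    intro X hX x y
    have hX' : X ∈ ω.skewAdjointSubmodule := hle hX
    rw [LinearMap.mem_skewAdjointSubmodule] at hX'
    have := hX' x y
    rwa [Pi.neg_apply, map_neg] at this
  -- the root `Y = s_{u₀ v₊}`, `u₀ ∈ U ∖ 0`
  obtain ⟨u₀, ⟨hu₀p, hu₀m⟩, hYu₀⟩ := exists_eq_symSq_of_conj_eq_I_smul hω hi h2 hpm hγp hγm hγU (hskew Y hYL) hY
  have hYeq : Y = symSq ω u₀ vp := by ext z; rw [hYu₀ z, symSq_apply]
  have hu₀ : u₀ ≠ 0 := by rintro rfl; exact hY0 (by rw [hYeq, symSq_zero_left])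
  have hu₀L : symSq ω u₀ vp ∈ L := hYeq ▸ hYL
  -- CASE 1: a transvection direction in `L`
  by_cases htd : ∃ x : V, x ≠ 0 ∧ symSq ω x x ∈ L
  · obtain ⟨x, hx, hxL⟩ := htd
    exact eq_skewAdjoint_of_isIrreducibleOn_of_symSq_self_mem hωn hω L hrad hle hirr hx hxL
  -- CASE 2: none — we derive a contradiction
  exfalso
  push Not at htd
  -- (a) roots at `v₋` are pairwise orthogonal: `[s_{a v₋}, s_{w v₋}] = ω(w,a) s_{v₋ v₋}`
  have horth : ∀ a w : V, ω a vm = 0 → ω w vm = 0 → symSq ω a vm ∈ L → symSq ω w vm ∈ L → ω a w = 0 := by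
    intro a w ham hwm haL hwL
    by_contra hne
    have hwa : ω w a ≠ 0 := by rw [← LinearMap.IsAlt.neg hω a w]; exact neg_ne_zero.2 hne
    have hbr : ⁅symSq ω a vm, symSq ω w vm⁆ = ω w a • symSq ω vm vm := by
      rw [LieRing.of_associative_ring_bracket, commutator_symSq_symSq_same_right hω ham hwm]
    have hm : symSq ω vm vm ∈ L := by
      have := L.smul_mem (ω w a)⁻¹ (L.lie_mem haL hwL)
      rwa [hbr, smul_smul, inv_mul_cancel₀ hwa, one_smul] at this
    exact htd vm hvm hm
  -- (b) no root `s_{u₀ v₋}` in `L`: `[s_{u₀ v₊}, s_{u₀ v₋}] = ω(v₋,v₊) s_{u₀ u₀}`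
  have hu₀m_not : ∀ c : K, c • symSq ω u₀ vm ∈ L → c = 0 := by
    intro c hc
    by_contra hc0
    have hm : symSq ω u₀ vm ∈ L := by
      have := L.smul_mem c⁻¹ hc
      rwa [smul_smul, inv_mul_cancel₀ hc0, one_smul] at this
    have hbr : ⁅symSq ω u₀ vp, symSq ω u₀ vm⁆ = ω vm vp • symSq ω u₀ u₀ := by
      rw [LieRing.of_associative_ring_bracket, commutator_symSq_plus_symSq_minus hω hu₀p hu₀m]
    have hm' : symSq ω u₀ u₀ ∈ L := by
      have := L.smul_mem (ω vm vp)⁻¹ (L.lie_mem hu₀L hm)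
      rwa [hbr, smul_smul, inv_mul_cancel₀ (by rw [hmp]; norm_num), one_smul] at this
    exact htd u₀ hu₀ hm'
  -- the subspace `W = K v₊ ⊕ {w ∈ U | s_{w v₋} ∈ L}` = `{z | ω(z,v₊) = 0, s_{z − ω(z,v₋)v₊, v₋} ∈ L}`
  let W : Submodule K V :=
    { carrier := {z | ω z vp = 0 ∧ symSq ω (z - ω z vm • vp) vm ∈ L}
      add_mem' := fun {a b} ha hb => by
        simp only [Set.mem_setOf_eq] at ha hb ⊢
        refine ⟨by rw [map_add, LinearMap.add_apply, ha.1, hb.1, add_zero], ?_⟩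
        have e : a + b - ω (a + b) vm • vp = (a - ω a vm • vp) + (b - ω b vm • vp) := by
          rw [map_add, LinearMap.add_apply]; module
        rw [e, symSq_add_left]; exact L.add_mem ha.2 hb.2
      zero_mem' := by
        simp only [Set.mem_setOf_eq, map_zero, LinearMap.zero_apply, zero_smul, sub_zero, symSq_zero_left, true_and]
        exact L.zero_mem
      smul_mem' := fun r {a} ha => by
        simp only [Set.mem_setOf_eq] at ha ⊢
        refine ⟨by rw [map_smul, LinearMap.smul_apply, ha.1, smul_eq_mul, mul_zero], ?_⟩
        have e : r • a - ω (r • a) vm • vp = r • (a - ω a vm • vp) := by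
          rw [map_smul, LinearMap.smul_apply]; module
        rw [e, symSq_smul_left]; exact L.smul_mem r ha.2 }
  have hmemW : ∀ z, z ∈ W ↔ ω z vp = 0 ∧ symSq ω (z - ω z vm • vp) vm ∈ L := fun z => Iff.rfl
  have hvpW : vp ∈ W := by
    rw [hmemW]; refine ⟨hω vp, ?_⟩
    rw [hpm, one_smul, sub_self, symSq_zero_left]; exact L.zero_mem
  have hUW : ∀ a, ω a vp = 0 → ω a vm = 0 → symSq ω a vm ∈ L → a ∈ W := fun a hap ham haL => by
    rw [hmemW]; refine ⟨hap, ?_⟩; rwa [ham, zero_smul, sub_zero]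
  -- members of `W` decompose as `z = ω(z,v₋) v₊ + a`, `a ∈ U`, `s_{a v₋} ∈ L`
  have hWdec : ∀ z ∈ W, ∃ a, ω a vp = 0 ∧ ω a vm = 0 ∧ symSq ω a vm ∈ L ∧ z = ω z vm • vp + a := by
    intro z hz
    rw [hmemW] at hz
    refine ⟨z - ω z vm • vp, ?_, ?_, hz.2, by abel⟩
    · rw [map_sub, map_smul, LinearMap.sub_apply, LinearMap.smul_apply, hz.1, hω vp, smul_eq_mul, mul_zero, sub_zero]
    · rw [map_sub, map_smul, LinearMap.sub_apply, LinearMap.smul_apply, hpm, smul_eq_mul, mul_one, sub_self]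
  -- `W` is `L`-stable: check the four `Ad γ`-components on `v₊` and on `a ∈ U` with `s_{a v₋} ∈ L`
  have hWstab : ∀ X ∈ L, ∀ z ∈ W, X z ∈ W := by
    intro X hX z hz
    obtain ⟨X₁, Xm, Xi, Xmi, h₁L, hmL, hiL, hmiL, hsum, h₁, hm, hI, hmI⟩ :=
      exists_components hω hi hpm hγp hγm hγU L.toSubmodule hL hX
    obtain ⟨a, hap, ham, haL, hza⟩ := hWdec z hz
    -- it suffices to treat each component on `v₊` and on `a`
    suffices hcomp : ∀ T : Module.End K V, (T = X₁ ∨ T = Xm ∨ T = Xi ∨ T = Xmi) → T vp ∈ W ∧ T a ∈ W by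
      have h4X : X z = (4 : K)⁻¹ • (X₁ z + Xm z + Xi z + Xmi z) := by
        have := congrArg (fun T : Module.End K V => T z) hsum
        simp only [LinearMap.smul_apply, LinearMap.add_apply] at this
        rw [← this, smul_smul, inv_mul_cancel₀ h4, one_smul]
      have hT : ∀ T : Module.End K V, (T = X₁ ∨ T = Xm ∨ T = Xi ∨ T = Xmi) → T z ∈ W := fun T hT => by
        obtain ⟨hTp, hTa⟩ := hcomp T hT
        rw [hza, map_add, map_smul]
        exact W.add_mem (W.smul_mem _ hTp) hTa
      rw [h4X]
      exact W.smul_mem _ (W.add_mem (W.add_mem (W.add_mem (hT X₁ (Or.inl rfl)) (hT Xm (Or.inr (Or.inl rfl))))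
        (hT Xi (Or.inr (Or.inr (Or.inl rfl))))) (hT Xmi (Or.inr (Or.inr (Or.inr rfl)))))
    rintro T (rfl | rfl | rfl | rfl)
    · -- `X₁` commutes with `γ`: `X₁ v₊ ∈ K v₊`, `X₁ v₋ ∈ K v₋`, `X₁ U ⊆ U`, `X₁ A₋ ⊆ A₋`
      have hTvp : T vp = ω (T vp) vm • vp :=
        eq_smul_plus_of_apply_eq hω hi h2 hpm hγp hγm hγU (by rw [h₁, hγp, map_smul])
      obtain ⟨c, hTvm⟩ : ∃ c : K, T vm = c • vm :=
        ⟨-ω (T vm) vp, by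
          rw [neg_smul]
          exact eq_smul_minus_of_apply_eq hω hi h2 hpm hγp hγm hγU (by rw [h₁, hγm, map_smul])⟩
      refine ⟨by rw [hTvp]; exact W.smul_mem _ hvpW, ?_⟩
      obtain ⟨hTap, hTam⟩ := mapsTo_U_of_conj_eq hω hi h2 hpm hγp hγm hγU h₁ hap ham
      refine hUW _ hTap hTam ?_
      have hbr : ⁅T, symSq ω a vm⁆ = symSq ω (T a) vm + c • symSq ω a vm := by
        rw [LieRing.of_associative_ring_bracket, commutator_symSq_of_skew (hskew T h₁L), hTvm, symSq_smul_right]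
      have := L.sub_mem (L.lie_mem h₁L haL) (L.smul_mem c haL)
      rwa [hbr, add_sub_cancel_right] at this
    · -- `X₋₁` kills `U`, and `X₋₁ v₊ = β v₋` with `β = 0` (no `s_{u₀ v₋}` in `L`)
      have hTa : T a = 0 := apply_eq_zero_of_conj_eq_neg hω hi h2 hpm hγp hγm hγU hm hap ham
      obtain ⟨β, hTvp⟩ : ∃ β : K, T vp = β • vm :=
        ⟨-ω (T vp) vp, by
          rw [neg_smul]
          exact eq_smul_minus_of_apply_eq hω hi h2 hpm hγp hγm hγU (by rw [hm, hγp, map_smul, neg_smul])⟩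
      have hβ : β = 0 := by
        apply hu₀m_not
        have hbr : ⁅T, symSq ω u₀ vp⁆ = β • symSq ω u₀ vm := by
          rw [LieRing.of_associative_ring_bracket, commutator_symSq_of_skew (hskew T hmL),
            apply_eq_zero_of_conj_eq_neg hω hi h2 hpm hγp hγm hγU hm hu₀p hu₀m, symSq_zero_left, zero_add, hTvp,
            symSq_smul_right]
        rw [← hbr]; exact L.lie_mem hmL hu₀L
      refine ⟨?_, by rw [hTa]; exact W.zero_mem⟩
      rw [hTvp, hβ, zero_smul]; exact W.zero_mem
    · -- `X_i = s_{u v₊}`, `u ∈ U`: `v₊ ↦ 0`, `a ↦ ω(a,u) v₊`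
      obtain ⟨u, ⟨hup, hum⟩, hTu⟩ := exists_eq_symSq_of_conj_eq_I_smul hω hi h2 hpm hγp hγm hγU (hskew T hiL) hI
      have hpu : ω vp u = 0 := by rw [← LinearMap.IsAlt.neg hω u vp, hup, neg_zero]
      refine ⟨?_, ?_⟩
      · rw [hTu vp, hpu, hω vp, zero_smul, zero_smul, add_zero]; exact W.zero_mem
      · rw [hTu a, hap, zero_smul, add_zero]; exact W.smul_mem _ hvpW
    · -- `X₋ᵢ = s_{w₁ v₋}`, `w₁ ∈ A₋`: `v₊ ↦ w₁`, `a ↦ ω(a,w₁) v₋ = 0`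
      obtain ⟨w₁, ⟨hw₁p, hw₁m⟩, hTw₁⟩ :=
        exists_eq_symSq_of_conj_eq_neg_I_smul hω hi h2 hpm hγp hγm hγU (hskew T hmiL) hmI
      have hTeq : T = symSq ω w₁ vm := by ext z; rw [hTw₁ z, symSq_apply]
      have hw₁L : symSq ω w₁ vm ∈ L := hTeq ▸ hmiL
      have hpw : ω vp w₁ = 0 := by rw [← LinearMap.IsAlt.neg hω w₁ vp, hw₁p, neg_zero]
      refine ⟨?_, ?_⟩
      · rw [hTw₁ vp, hpw, zero_smul, zero_add, hpm, one_smul]; exact hUW w₁ hw₁p hw₁m hw₁L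
      · rw [hTw₁ a, horth a w₁ ham hw₁m haL hw₁L, ham, zero_smul, zero_smul, add_zero]; exact W.zero_mem
  -- irreducibility: `W = ⊤`, so `v₋ ∈ W`, i.e. `ω(v₋, v₊) = 0` — contradiction
  rcases hirr W hWstab with hbot | htop
  · have : vp ∈ (⊥ : Submodule K V) := hbot ▸ hvpW
    rw [Submodule.mem_bot] at this
    exact hvp this
  · have hvmW : vm ∈ W := htop ▸ Submodule.mem_top
    rw [hmemW, hmp] at hvmW
    norm_num at hvmW

include hωn hω hi hpm hγp hγm hγU in
/-- **Lemma BL, unconditional** (any field of characteristic `0` containing `i`; trivial radical assumed): `L ≤ 𝔰𝔭(M, ω)`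
a Lie subalgebra with trivial radical, stable under `X ↦ γ X γ⁻¹` for an `(i, −i)`-bireflection datum `(v₊, v₋, γ)`, with no
`L`-stable subspace other than `⊥`, `⊤`, `dim M ≥ 3` ⟹ `L = 𝔰𝔭(M, ω)`.  ((G2) of the tree supplies a non-zero `±i`-eigen
operator; the `−i` case is the `i` case of the datum `(v₋, −v₊, −i)`.) NO Katz fact is used.
[cite: Katz1990ESDE, Ch. 1, proof of Thm. 1.0 (p. 9) and Thms. 1.4–1.5 (pp. 10–11, superseded here)] -/
theorem eq_skewAdjoint_of_isIrreducibleOn_of_conj_mem :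
    letI : LieRing (Module.End K V) := LieRing.ofAssociativeRing
    letI : LieAlgebra K (Module.End K V) := LieAlgebra.ofAssociativeAlgebra
    ∀ (L : LieSubalgebra K (Module.End K V)), LieAlgebra.HasTrivialRadical K L → L ≤ skewAdjointLieSubalgebra ω →
      (∀ X ∈ L, γ.conj X ∈ L) → IsIrreducibleOn L → 3 ≤ finrank K V → L = skewAdjointLieSubalgebra ω := by
  letI : LieRing (Module.End K V) := LieRing.ofAssociativeRing
  letI : LieAlgebra K (Module.End K V) := LieAlgebra.ofAssociativeAlgebra
  intro L hrad hle hL hirr h3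
  have h2 : (2 : K) ≠ 0 := two_ne_zero
  obtain ⟨Y, hYL, hY0, hY | hY⟩ :=
    exists_ne_zero_conj_eq_I_smul_or hω hi h2 hpm hγp hγm hγU L.toSubmodule (fun X hX => hL X hX) hirr h3
  · exact eq_skewAdjoint_of_conj_mem_of_I_eigen hωn hω hi hpm hγp hγm hγU L hrad hle hL hirr hYL hY0 hY
  · -- the datum `(v₋, −v₊, −i)`
    have hi' : (-i) * (-i) = -1 := by rw [neg_mul_neg, hi]
    have hpm' : ω vm (-vp) = 1 := by rw [map_neg, ← LinearMap.IsAlt.neg hω vp vm, hpm, neg_neg]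
    have hγp' : γ vm = (-i) • vm := hγm
    have hγm' : γ (-vp) = (-(-i)) • (-vp) := by rw [map_neg, hγp, neg_neg, smul_neg]
    have hγU' : ∀ x, ω x vm = 0 → ω x (-vp) = 0 → γ x = x := fun x h1 h2' => by
      rw [map_neg, neg_eq_zero] at h2'; exact hγU x h2' h1
    exact eq_skewAdjoint_of_conj_mem_of_I_eigen hωn hω hi' hpm' hγp' hγm' hγU' L hrad hle hL hirr hYL hY0 hY

end Core

/-- **Lemma BL, unconditional, over an ALGEBRAICALLY CLOSED field of characteristic `0`** (no radical hypothesis: an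
irreducible `L ≤ 𝔰𝔭(M, ω)` has trivial radical, tree `IrreducibleSkewAdjoint.hasTrivialRadical_of_irreducible_of_le_skewAdjoint`)
— the drop-in replacement of `Q8BireflectionLieDensity.eq_skewAdjoint_of_bireflection` with the four Katz facts, the isometry
hypothesis `hγω` and `6 ≤ dim M ≠ 7` removed (`3 ≤ dim M` suffices).
[cite: Katz1990ESDE, Ch. 1, proof of Thm. 1.0 (p. 9) and Thms. 1.4–1.5 (pp. 10–11, superseded here)] [cite: Humphreys1972, §19.1] -/
theorem eq_skewAdjoint_of_isIrreducibleOn_of_conj_mem' [IsAlgClosed K] [CharZero K] [FiniteDimensional K V]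
    {ω : BilinForm K V} (hωn : ω.Nondegenerate) (hω : ω.IsAlt) {i : K} (hi : i * i = -1) {vp vm : V}
    (hpm : ω vp vm = 1) {γ : V ≃ₗ[K] V} (hγp : γ vp = i • vp) (hγm : γ vm = (-i) • vm)
    (hγU : ∀ x, ω x vp = 0 → ω x vm = 0 → γ x = x) :
    letI : LieRing (Module.End K V) := LieRing.ofAssociativeRing
    letI : LieAlgebra K (Module.End K V) := LieAlgebra.ofAssociativeAlgebra
    ∀ (L : LieSubalgebra K (Module.End K V)), L ≤ skewAdjointLieSubalgebra ω → (∀ X ∈ L, γ.conj X ∈ L) →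
      IsIrreducibleOn L → 3 ≤ finrank K V → L = skewAdjointLieSubalgebra ω := by
  letI : LieRing (Module.End K V) := LieRing.ofAssociativeRing
  letI : LieAlgebra K (Module.End K V) := LieAlgebra.ofAssociativeAlgebra
  intro L hle hL hirr h3
  have hvp : vp ≠ 0 := by rintro rfl; rw [map_zero, LinearMap.zero_apply] at hpm; exact zero_ne_one hpm
  haveI : Nontrivial V := ⟨⟨vp, 0, hvp⟩⟩
  haveI : LieAlgebra.HasTrivialRadical K L :=
    IrreducibleSkewAdjoint.hasTrivialRadical_of_irreducible_of_le_skewAdjoint hωn hω L hle hirr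
  exact eq_skewAdjoint_of_isIrreducibleOn_of_conj_mem hωn hω hi hpm hγp hγm hγU L ‹_› hle hL hirr h3

end SymplecticBireflection

end Literature.Algebra.Lie
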